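import Literature.NumberTheory.GaloisRepresentations.LubinTateComparisonPoints
import Literature.NumberTheory.EllipticCurves.BDPAnticyclotomicPAdicLFunction
import HarnessLib

/-!
# A `p`-adic reading `θ : ℂ_F → ℂ_p` maps `𝒪̂_{F_nr}` into `R₀ = 𝒪̂_{ℚ_p^nr} ⊂ ℂ_p` (`unrIntegers p`)

Topic `NumberTheory/PAdicHodge`; namespace `Literature.NumberTheory.PAdicHodge`.  Cell `bsd-print-cf2`, width seat
`bsd-line-cf2-p1-w5` g17, piece «R0-UNIT» of the `j = 0` Katz-measure lane (print leaf stmt-BirchSwinnertonDyer-24720):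
the lane's supply statement binds the `p`-adic period as a unit `Ωp : (unrIntegers 2)ˣ` of `R₀`, while the seam
identity delivers it as `Θ(ε_ϑ) · A₁ ∈ ℂ₂` with `Θ = θ ∘ (𝒪̂_{F_nr} → 𝒪_{ℂ_F})` for the lane's reading
`θ : ℂ_F →+* ℂ_[2]` (`‖θ z‖ ≤ 1` on the unit ball) and `ε_ϑ ∈ (𝒪̂_{F_nr})ˣ` the linear coefficient of the
Lubin–Tate comparison series.  THIS FILE (generic; `F` a non-archimedean local field in which `p` is a UNIFORMISER,
`θ : ℂ_F →+* ℂ_[p]` any ring map with `‖θ z‖ ≤ 1` for `‖z‖ ≤ 1` — no continuity, no bijectivity):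
* §1–§2 ★ `exists_mem_closure_roots_add_pow_mul` — TEICHMÜLLER EXPANSION in `𝒪_{F_nr}`: every `b ∈ 𝒪_{F_nr}` is
  `s + pⁿ·c` with `s ∈ ℤ[μ_{p'}(F̄)]` and `c ∈ 𝒪_{F_nr}` (Serre, *Local Fields*, Ch. II §4 Prop. 8; tree
  `exists_rootOfUnity_sub_mem_absMaximalIdeal`, `maximalIdeal_eq_span_uniformizer`); hence
  ★ `mem_unrIntegers_theta_algClosureToC`: `θ(b) ∈ R₀` (`R₀` is closed, `‖pⁿ θ(c)‖ ≤ ‖p‖ⁿ → 0`);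
* §3 ★★ `mem_unrIntegers_theta_toC` — **`θ (toC x) ∈ R₀` for every `x ∈ 𝒪̂_{F_nr}`** (`x ≡ b_n (mod ϖⁿ)` with
  `b_n ∈ 𝒪_{F_nr}`: `mk_toCInt`, `mem_span_pow_iff`); units go to units (`exists_units_unrIntegers_coe_eq_theta_toC`);
* §4–§5 the lane's spelling `Θ := θ.comp ((CBall F).subtype.comp (algebraMap (UnrCoeff F) (CBall F)))`:
  `mem_unrIntegers_thetaC[_of_isUniformizer]`, and ★★ `exists_units_unrIntegers_coe_eq_thetaC_coeff_one_compSeriesC_mul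
  [_of_isUniformizer]` — **`∃ Ωp : (unrIntegers p)ˣ, ↑Ωp = Θ(coeff 1 ϑ) · θ(a)`** for `ϑ = compSeriesC hπ hσ₀ u hε`
  (tree `isUnit_coeff_one_compSeriesC`) and `a ∈ 𝒪[F]ˣ`; `§5` takes the uniformiser hypothesis in the lane's form
  `(valuation F).IsUniformizer p` (the local datum's `h2`, which also builds `ϑ`), with the `Ωp ^ m` form.

HONEST FRAMING: valuation-theoretic plumbing (Serre, *Local Fields*, Ch. II §4–§5: `𝒪̂_{ℚ_p^nr} = W(𝔽̄_p)` is the closure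
of `ℤ_p[μ_{p'}]`; de Shalit II.4.12 (31): the period `Ω_p ∈ 𝒪̂_{ℚ_p^nr}ˣ`); theorems only, no `def`, no named fact,
no `sorry`; BSD is not advanced by this file.

## References
* [SerreLocalFields1979] J.-P. Serre, *Local Fields*, GTM 67, Ch. II §4 Prop. 8 (multiplicative representatives),
  Ch. II §5 (`W(k̄)`), Ch. IV §4 Cor. 2 to Prop. 16 (`K_nr = K(μ_{p'})`).
* [deShalit1987] E. de Shalit, *Iwasawa theory of elliptic curves with complex multiplication*, II.4.12 (31) (p. 67).
-/

noncomputable section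
open ValuativeRel Field IsLocalRing Filter Topology AdicCompletion

namespace Literature.NumberTheory.PAdicHodge
open Literature.NumberTheory.GaloisRepresentations Literature.NumberTheory.GaloisRepresentations.IsNonarchimedeanLocalField
open Literature.NumberTheory.EllipticCurves (unrIntegers mem_unrIntegers_of_pow_eq_one isClosed_unrIntegers)

variable {F : Type} [Field F] [ValuativeRel F] [TopologicalSpace F] [IsNonarchimedeanLocalField F]
variable {p : ℕ} [Fact p.Prime]

/-! ### §0. Two limit templates in `ℂ_p` -/
variable (p) in
/-- `‖p‖ < 1` in `ℂ_p`. [folklore] -/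
private theorem norm_natCast_p_lt_one : ‖(p : ℂ_[p])‖ < 1 := by
  rw [← map_natCast (algebraMap ℚ_[p] ℂ_[p]) p, norm_algebraMap']
  exact Padic.norm_p_lt_one

/-- A point of `ℂ_p` within `‖p‖ⁿ` of `R₀` for every `n` lies in `R₀` (`R₀` is closed). [folklore] -/
private theorem mem_unrIntegers_of_forall_exists_norm_sub_le {L : ℂ_[p]}
    (h : ∀ n : ℕ, ∃ y ∈ unrIntegers p, ‖L - y‖ ≤ ‖(p : ℂ_[p])‖ ^ n) : L ∈ unrIntegers p := by
  choose y hy hLy using h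
  have hlim : Tendsto y atTop (𝓝 L) := by
    rw [tendsto_iff_norm_sub_tendsto_zero]
    refine squeeze_zero (fun n ↦ norm_nonneg _) (fun n ↦ ?_)
      (tendsto_pow_atTop_nhds_zero_of_lt_one (norm_nonneg _) (norm_natCast_p_lt_one p))
    rw [norm_sub_rev]; exact hLy n
  exact isClosed_unrIntegers.mem_of_tendsto hlim (Eventually.of_forall hy)

/-! ### §1. Roots of unity of order prime to `p` are read into `R₀` -/
omit [TopologicalSpace F] [IsNonarchimedeanLocalField F] [Fact p.Prime] in
/-- If `p` is a uniformiser of `𝒪[F]`, a natural number which is a unit of `𝒪[F]` is positive and prime to `p`. [folklore] -/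
private theorem pos_and_not_dvd_of_isUnit_natCast (hp : Irreducible ((p : ℕ) : 𝒪[F])) {N : ℕ}
    (hN : IsUnit ((N : ℕ) : 𝒪[F])) : 0 < N ∧ ¬ p ∣ N := by
  refine ⟨Nat.pos_of_ne_zero ?_, ?_⟩
  · rintro rfl
    rw [Nat.cast_zero] at hN
    have h01 : (0 : 𝒪[F]) = 1 := isUnit_zero_iff.mp hN
    exact hp.ne_zero (by rw [← mul_one ((p : ℕ) : 𝒪[F]), ← h01, mul_zero])
  · rintro ⟨m, rfl⟩
    rw [Nat.cast_mul] at hN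
    exact hp.not_isUnit (isUnit_of_mul_isUnit_left hN)

/-- The subring `ℤ[μ_{p'}(F̄)] ⊆ F̄` generated by the roots of unity of order a unit of `𝒪[F]` lies in `𝒪_{F_nr}`
(`F_nr = F(μ_{p'})`, roots of unity are integral). [cite: SerreLocalFields1979, Ch. IV §4 Cor. 2 to Prop. 16] -/
theorem closure_roots_le_maxUnramifiedIntegers :
    Subring.closure {ζ : AlgebraicClosure F | ∃ N : ℕ, IsUnit ((N : ℕ) : 𝒪[F]) ∧ ζ ^ N = 1} ≤
      (maxUnramifiedIntegers F).toSubring := by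
  refine Subring.closure_le.mpr ?_
  rintro ζ ⟨N, hN, hζ⟩
  have hnr : ζ ∈ maxUnramified F := IntermediateField.subset_adjoin F _ ⟨N, hN, hζ⟩
  have hNpos : N ≠ 0 := by
    rintro rfl
    rw [Nat.cast_zero] at hN
    have h01 : (0 : 𝒪[F]) = 1 := isUnit_zero_iff.mp hN
    exact zero_ne_one h01
  have hint : ζ ∈ absIntegers 𝒪[F] F := by
    refine mem_absIntegers_iff_algNorm_le_one.mpr ?_
    have h1 : algNorm F ζ ^ N = 1 := by rw [← algNorm_pow, hζ, algNorm_one]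
    exact ((pow_eq_one_iff_of_nonneg (algNorm_nonneg ζ) hNpos).mp h1).le
  exact mem_maxUnramifiedIntegers_iff.mpr ⟨hint, hnr⟩

/-- **`ℤ[μ_{p'}(F̄)]` is read into `R₀`** by any ring map `θ : ℂ_F →+* ℂ_p` (`p` a uniformiser: roots of unity of order
prime to `p` go to such roots of unity). [cite: SerreLocalFields1979, Ch. II §5] -/
theorem mem_unrIntegers_theta_algClosureToC_of_mem_closure_roots (hp : Irreducible ((p : ℕ) : 𝒪[F]))
    (θ : CompletedAlgClosure F →+* ℂ_[p]) {s : AlgebraicClosure F}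
    (hs : s ∈ Subring.closure {ζ : AlgebraicClosure F | ∃ N : ℕ, IsUnit ((N : ℕ) : 𝒪[F]) ∧ ζ ^ N = 1}) :
    θ (algClosureToC F s) ∈ unrIntegers p := by
  have hle : Subring.closure {ζ : AlgebraicClosure F | ∃ N : ℕ, IsUnit ((N : ℕ) : 𝒪[F]) ∧ ζ ^ N = 1} ≤
      (unrIntegers p).comap (θ.comp (algClosureToC F)) := by
    refine Subring.closure_le.mpr ?_
    rintro ζ ⟨N, hN, hζ⟩
    obtain ⟨hN0, hpN⟩ := pos_and_not_dvd_of_isUnit_natCast hp hN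
    rw [SetLike.mem_coe, Subring.mem_comap]
    exact mem_unrIntegers_of_pow_eq_one hN0 hpN (by rw [← map_pow, hζ, map_one])
  exact hle hs

/-! ### §2. Teichmüller expansion in `𝒪_{F_nr}` and the reading of `𝒪_{F_nr}` -/
omit [Fact p.Prime] in
/-- **Teichmüller expansion** (Serre, *Local Fields*, Ch. II §4 Prop. 8): if `p` is a uniformiser of `𝒪[F]`, every
`b ∈ 𝒪_{F_nr}` is `s + pⁿ·c` with `s ∈ ℤ[μ_{p'}(F̄)]` and `c ∈ 𝒪_{F_nr}`, for every `n` (the residues of the DVR `𝒪_{F_nr}`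
are residues of roots of unity of order prime to `p`: tree `exists_rootOfUnity_sub_mem_absMaximalIdeal`).
[cite: SerreLocalFields1979, Ch. II §4 Prop. 8] -/
theorem exists_mem_closure_roots_add_pow_mul (hp : Irreducible ((p : ℕ) : 𝒪[F])) (n : ℕ)
    (b : maxUnramifiedIntegers F) :
    ∃ s ∈ Subring.closure {ζ : AlgebraicClosure F | ∃ N : ℕ, IsUnit ((N : ℕ) : 𝒪[F]) ∧ ζ ^ N = 1},
      ∃ c : maxUnramifiedIntegers F,
        (b : AlgebraicClosure F) = s + (p : AlgebraicClosure F) ^ n * (c : AlgebraicClosure F) := by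
  classical
  set R := Subring.closure {ζ : AlgebraicClosure F | ∃ N : ℕ, IsUnit ((N : ℕ) : 𝒪[F]) ∧ ζ ^ N = 1} with hR
  induction n generalizing b with
  | zero => exact ⟨0, R.zero_mem, b, by rw [pow_zero, one_mul, zero_add]⟩
  | succ n ih =>
    -- the uniformiser `p` of `𝒪_{F_nr}`
    have hmax : IsLocalRing.maximalIdeal (maxUnramifiedIntegers F) =
        Ideal.span {algebraMap 𝒪[F] (maxUnramifiedIntegers F) (p : 𝒪[F])} :=
      maximalIdeal_eq_span_uniformizer (F := F) hp
    have hcoep : ((algebraMap 𝒪[F] (maxUnramifiedIntegers F) (p : 𝒪[F]) : maxUnramifiedIntegers F) :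
        AlgebraicClosure F) = (p : AlgebraicClosure F) := by
      rw [map_natCast]; rfl
    -- first digit: `b ≡ ζ₀ (mod p)` with `ζ₀ = 0` or a root of unity of order prime to `p`
    obtain ⟨ζ₀, hζ₀R, b', hb'⟩ : ∃ ζ₀ ∈ R, ∃ b' : maxUnramifiedIntegers F,
        (b : AlgebraicClosure F) = ζ₀ + (p : AlgebraicClosure F) * (b' : AlgebraicClosure F) := by
      by_cases hb : b ∈ IsLocalRing.maximalIdeal (maxUnramifiedIntegers F)
      · rw [hmax, Ideal.mem_span_singleton'] at hb
        obtain ⟨b', hb'⟩ := hb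
        refine ⟨0, R.zero_mem, b', ?_⟩
        rw [zero_add, ← hcoep, ← Subalgebra.coe_mul, mul_comm, hb']
      · have hb𝔓 : maxUnramifiedIntegers.toAbsIntegers F b ∉ absMaximalIdeal F := by
          rwa [maximalIdeal_eq_comap_absMaximalIdeal, Ideal.mem_comap] at hb
        obtain ⟨N, ζ, hN, hζN, hbζ⟩ := exists_rootOfUnity_sub_mem_absMaximalIdeal hb𝔓
        have hζpow : ((ζ : absIntegers 𝒪[F] F) : AlgebraicClosure F) ^ N = 1 := by
          rw [← Subalgebra.coe_pow, hζN, Subalgebra.coe_one]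
        have hζnr : ((ζ : absIntegers 𝒪[F] F) : AlgebraicClosure F) ∈ maxUnramifiedIntegers F :=
          closure_roots_le_maxUnramifiedIntegers (Subring.subset_closure ⟨N, hN, hζpow⟩)
        set ζ' : maxUnramifiedIntegers F := ⟨(ζ : AlgebraicClosure F), hζnr⟩ with hζ'
        have hζ'ζ : maxUnramifiedIntegers.toAbsIntegers F ζ' = ζ := Subtype.ext rfl
        have hdiff : b - ζ' ∈ IsLocalRing.maximalIdeal (maxUnramifiedIntegers F) := by
          rw [maximalIdeal_eq_comap_absMaximalIdeal, Ideal.mem_comap, map_sub, hζ'ζ]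
          exact hbζ
        rw [hmax, Ideal.mem_span_singleton'] at hdiff
        obtain ⟨b', hb'⟩ := hdiff
        refine ⟨(ζ : AlgebraicClosure F), Subring.subset_closure ⟨N, hN, hζpow⟩, b', ?_⟩
        have h := congrArg (fun z : maxUnramifiedIntegers F ↦ (z : AlgebraicClosure F)) hb'
        simp only [Subalgebra.coe_mul, hcoep, Subalgebra.coe_sub] at h
        rw [mul_comm] at h
        rw [h]
        change (b : AlgebraicClosure F) = (ζ : AlgebraicClosure F) + ((b : AlgebraicClosure F) - (ζ : AlgebraicClosure F))
        ring
    -- the remaining digits from the induction hypothesis applied to `b'`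
    obtain ⟨s', hs'R, c, hc⟩ := ih b'
    refine ⟨ζ₀ + (p : AlgebraicClosure F) * s', R.add_mem hζ₀R (R.mul_mem (natCast_mem R p) hs'R), c, ?_⟩
    rw [hb', hc]; ring

/-- Elements of `𝒪_{F_nr}` are read into the closed unit ball of `ℂ_p`. [folklore] -/
private theorem norm_theta_algClosureToC_le_one (θ : CompletedAlgClosure F →+* ℂ_[p])
    (hθ1 : ∀ z : CompletedAlgClosure F, ‖z‖ ≤ 1 → ‖θ z‖ ≤ 1) (c : maxUnramifiedIntegers F) :
    ‖θ (algClosureToC F (c : AlgebraicClosure F))‖ ≤ 1 :=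
  hθ1 _ (by rw [norm_algClosureToC]; exact algNorm_coe_maxUnramifiedIntegers_le_one c)

/-- **`𝒪_{F_nr}` is read into `R₀`** by any ring map `θ : ℂ_F →+* ℂ_p` with `‖θ z‖ ≤ 1` for `‖z‖ ≤ 1` (`p` a uniformiser):
`θ(b) = θ(s_n) + pⁿ θ(c_n)` is within `‖p‖ⁿ` of the closed subring `R₀` for every `n`. [cite: SerreLocalFields1979, Ch. II §5] -/
theorem mem_unrIntegers_theta_algClosureToC (hp : Irreducible ((p : ℕ) : 𝒪[F]))
    (θ : CompletedAlgClosure F →+* ℂ_[p]) (hθ1 : ∀ z : CompletedAlgClosure F, ‖z‖ ≤ 1 → ‖θ z‖ ≤ 1)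
    (b : maxUnramifiedIntegers F) :
    θ (algClosureToC F (b : AlgebraicClosure F)) ∈ unrIntegers p := by
  refine mem_unrIntegers_of_forall_exists_norm_sub_le fun n ↦ ?_
  obtain ⟨s, hs, c, hc⟩ := exists_mem_closure_roots_add_pow_mul hp n b
  refine ⟨θ (algClosureToC F s), mem_unrIntegers_theta_algClosureToC_of_mem_closure_roots hp θ hs, ?_⟩
  rw [hc, map_add, map_add, add_sub_cancel_left, map_mul, map_mul, map_pow, map_pow, map_natCast, map_natCast,
    norm_mul, norm_pow]
  exact mul_le_of_le_one_right (pow_nonneg (norm_nonneg _) n) (norm_theta_algClosureToC_le_one θ hθ1 c)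

/-! ### §3. The reading of the completion `𝒪̂_{F_nr}` -/
/-- Units of `𝒪[F]` have norm `1` in `ℂ_F`. [folklore] -/
private theorem norm_algebraMap_units_eq_one (w : 𝒪[F]ˣ) :
    ‖algebraMap F (CompletedAlgClosure F) ((w : 𝒪[F]) : F)‖ = 1 := by
  have hle : ∀ a : 𝒪[F], ‖algebraMap F (CompletedAlgClosure F) (a : F)‖ ≤ 1 := fun a ↦ by
    rw [CompletedAlgClosure.norm_algebraMap]; exact (norm_le_one_iff F _).mpr a.2
  have hmul : ‖algebraMap F (CompletedAlgClosure F) ((w : 𝒪[F]) : F)‖ *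
      ‖algebraMap F (CompletedAlgClosure F) ((w⁻¹ : 𝒪[F]ˣ) : 𝒪[F])‖ = 1 := by
    rw [← norm_mul, ← map_mul, ← Subring.coe_mul, ← Units.val_mul, mul_inv_cancel, Units.val_one,
      OneMemClass.coe_one, map_one, norm_one]
  have hb := hle ((w⁻¹ : 𝒪[F]ˣ) : 𝒪[F])
  exact le_antisymm (hle _) (by nlinarith [hle (w : 𝒪[F]), norm_nonneg (algebraMap F (CompletedAlgClosure F) (w : F))])

omit [Fact p.Prime] in
/-- If `p` is a uniformiser of `𝒪[F]`, every uniformiser has the norm of `p` in `ℂ_F`. [folklore] -/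
private theorem norm_algebraMap_eq_norm_natCast_of_irreducible (hp : Irreducible ((p : ℕ) : 𝒪[F])) {ϖ : 𝒪[F]}
    (hϖ : Irreducible ϖ) :
    ‖algebraMap F (CompletedAlgClosure F) (ϖ : F)‖ = ‖(p : CompletedAlgClosure F)‖ := by
  obtain ⟨w, hw⟩ := IsDiscreteValuationRing.associated_of_irreducible 𝒪[F] hϖ hp
  have h : (p : CompletedAlgClosure F) =
      algebraMap F (CompletedAlgClosure F) (ϖ : F) * algebraMap F (CompletedAlgClosure F) ((w : 𝒪[F]) : F) := by
    rw [← map_mul, ← Subring.coe_mul, hw]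
    simp
  rw [h, norm_mul, norm_algebraMap_units_eq_one, mul_one]

omit [Fact p.Prime] in
/-- `p ≠ 0` in `ℂ_F` when `p` is a uniformiser of `𝒪[F]`, with `0 < ‖p‖`. [folklore] -/
private theorem norm_natCast_pos_of_irreducible (hp : Irreducible ((p : ℕ) : 𝒪[F])) :
    0 < ‖(p : CompletedAlgClosure F)‖ := by
  letI := nontriviallyNormedField F
  rw [← norm_algebraMap_eq_norm_natCast_of_irreducible hp hp, CompletedAlgClosure.norm_algebraMap]
  exact norm_pos_iff.mpr fun h ↦ hp.ne_zero (Subtype.ext h)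

omit [Fact p.Prime] in
/-- **Approximation of `𝒪̂_{F_nr}` by `𝒪_{F_nr}` inside `ℂ_F`**: `‖toC x - b‖ ≤ ‖p‖ⁿ` for some `b ∈ 𝒪_{F_nr}`
(`x ≡ b (mod 𝔪̂ⁿ)`, the defining congruences `mk_toCInt` of `toC`). [cite: SerreLocalFields1979, Ch. II §5] -/
theorem exists_norm_toC_sub_algClosureToC_le (hp : Irreducible ((p : ℕ) : 𝒪[F]))
    (x : maxUnramifiedCompletion F) (n : ℕ) :
    ∃ b : maxUnramifiedIntegers F,
      ‖maxUnramifiedCompletion.toC F x - algClosureToC F (b : AlgebraicClosure F)‖ ≤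
        ‖(p : CompletedAlgClosure F)‖ ^ n := by
  classical
  have hϖ : Irreducible (exists_irreducible_integer (F := F)).choose := (exists_irreducible_integer (F := F)).choose_spec
  obtain ⟨b, hb⟩ := Ideal.Quotient.mk_surjective
    (evalₐ (IsLocalRing.maximalIdeal (maxUnramifiedIntegers F)) n x)
  refine ⟨b, ?_⟩
  have hmk : Ideal.Quotient.mk (Ideal.span {unifC (exists_irreducible_integer (F := F)).choose} ^ n) (toCInt hϖ x) =
      Ideal.Quotient.mk (Ideal.span {unifC (exists_irreducible_integer (F := F)).choose} ^ n)
        (ofMaxUnramifiedIntegers F b) := by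
    rw [mk_toCInt, fam_apply, ← hb, Ideal.quotientMap_mk]
  have hmem : toCInt hϖ x - ofMaxUnramifiedIntegers F b ∈
      Ideal.span {unifC (exists_irreducible_integer (F := F)).choose} ^ n := Ideal.Quotient.eq.mp hmk
  rw [mem_span_pow_iff (coe_unifC_ne_zero hϖ), coe_unifC, norm_algebraMap_eq_norm_natCast_of_irreducible hp hϖ,
    AddSubgroupClass.coe_sub] at hmem
  exact hmem

/-- ★★ **`𝒪̂_{F_nr}` is read into `R₀`**: `θ (toC x) ∈ unrIntegers p` for every `x ∈ 𝒪̂_{F_nr}`, for `p` a uniformiser of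
`𝒪[F]` and any ring map `θ : ℂ_F →+* ℂ_p` with `‖θ z‖ ≤ 1` whenever `‖z‖ ≤ 1`. [cite: SerreLocalFields1979, Ch. II §5] -/
theorem mem_unrIntegers_theta_toC (hp : Irreducible ((p : ℕ) : 𝒪[F]))
    (θ : CompletedAlgClosure F →+* ℂ_[p]) (hθ1 : ∀ z : CompletedAlgClosure F, ‖z‖ ≤ 1 → ‖θ z‖ ≤ 1)
    (x : maxUnramifiedCompletion F) :
    θ (maxUnramifiedCompletion.toC F x) ∈ unrIntegers p := by
  refine mem_unrIntegers_of_forall_exists_norm_sub_le fun n ↦ ?_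
  obtain ⟨b, hb⟩ := exists_norm_toC_sub_algClosureToC_le hp x n
  refine ⟨θ (algClosureToC F (b : AlgebraicClosure F)), mem_unrIntegers_theta_algClosureToC hp θ hθ1 b, ?_⟩
  -- `toC x - b = p^n · z` with `‖z‖ ≤ 1`
  have hp0 : (p : CompletedAlgClosure F) ^ n ≠ 0 := pow_ne_zero n (norm_pos_iff.mp (norm_natCast_pos_of_irreducible hp))
  set d := maxUnramifiedCompletion.toC F x - algClosureToC F (b : AlgebraicClosure F) with hd
  have hz : ‖d / (p : CompletedAlgClosure F) ^ n‖ ≤ 1 := by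
    rw [norm_div, norm_pow, div_le_one (by rw [← norm_pow]; exact norm_pos_iff.mpr hp0)]
    exact hb
  have hdeq : d = (p : CompletedAlgClosure F) ^ n * (d / (p : CompletedAlgClosure F) ^ n) := by
    rw [mul_div_cancel₀ _ hp0]
  rw [← map_sub, ← hd, hdeq, map_mul, map_pow, map_natCast, norm_mul, norm_pow]
  exact mul_le_of_le_one_right (pow_nonneg (norm_nonneg _) n) (hθ1 _ hz)

/-- `𝒪[F]` is read into `R₀`: `θ (a) ∈ unrIntegers p` for `a ∈ 𝒪[F]` (`p` a uniformiser). [cite: SerreLocalFields1979, Ch. II §5] -/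
theorem mem_unrIntegers_theta_algebraMap (hp : Irreducible ((p : ℕ) : 𝒪[F]))
    (θ : CompletedAlgClosure F →+* ℂ_[p]) (hθ1 : ∀ z : CompletedAlgClosure F, ‖z‖ ≤ 1 → ‖θ z‖ ≤ 1) (a : 𝒪[F]) :
    θ (algebraMap F (CompletedAlgClosure F) (a : F)) ∈ unrIntegers p := by
  rw [← toC_algebraMap]
  exact mem_unrIntegers_theta_toC hp θ hθ1 _

/-- ★ **Units of `𝒪̂_{F_nr}` are read into `R₀ˣ`**: `↑Ωp = θ (toC x)` for some `Ωp : (unrIntegers p)ˣ` (the shape in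
which `p`-adic periods are booked). [cite: deShalit1987, II.4.12 (31) (p. 67)] -/
theorem exists_units_unrIntegers_coe_eq_theta_toC (hp : Irreducible ((p : ℕ) : 𝒪[F]))
    (θ : CompletedAlgClosure F →+* ℂ_[p]) (hθ1 : ∀ z : CompletedAlgClosure F, ‖z‖ ≤ 1 → ‖θ z‖ ≤ 1)
    (x : (maxUnramifiedCompletion F)ˣ) :
    ∃ Ωp : (unrIntegers p)ˣ, (Ωp : ℂ_[p]) = θ (maxUnramifiedCompletion.toC F (x : maxUnramifiedCompletion F)) := by
  refine ⟨Units.mkOfMulEqOne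
    ⟨θ (maxUnramifiedCompletion.toC F (x : maxUnramifiedCompletion F)), mem_unrIntegers_theta_toC hp θ hθ1 _⟩
    ⟨θ (maxUnramifiedCompletion.toC F ((x⁻¹ : (maxUnramifiedCompletion F)ˣ) : maxUnramifiedCompletion F)),
      mem_unrIntegers_theta_toC hp θ hθ1 _⟩ (Subtype.ext ?_), rfl⟩
  change θ _ * θ _ = 1
  rw [← map_mul, ← map_mul, ← Units.val_mul, mul_inv_cancel, Units.val_one, map_one, map_one]

/-- A product of two images of units of `R₀` is the image of a unit of `R₀`. [folklore] -/
private theorem exists_units_unrIntegers_coe_eq_mul {y z : ℂ_[p]} (hy : ∃ w : (unrIntegers p)ˣ, (w : ℂ_[p]) = y)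
    (hz : ∃ w : (unrIntegers p)ˣ, (w : ℂ_[p]) = z) : ∃ Ωp : (unrIntegers p)ˣ, (Ωp : ℂ_[p]) = y * z := by
  obtain ⟨w₁, rfl⟩ := hy
  obtain ⟨w₂, rfl⟩ := hz
  exact ⟨w₁ * w₂, by rw [Units.val_mul, Subring.coe_mul]⟩

/-- Units of `𝒪[F]` are read into `R₀ˣ`. [cite: deShalit1987, II.4.12 (31) (p. 67)] -/
theorem exists_units_unrIntegers_coe_eq_theta_algebraMap (hp : Irreducible ((p : ℕ) : 𝒪[F]))
    (θ : CompletedAlgClosure F →+* ℂ_[p]) (hθ1 : ∀ z : CompletedAlgClosure F, ‖z‖ ≤ 1 → ‖θ z‖ ≤ 1) (a : 𝒪[F]ˣ) :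
    ∃ Ωp : (unrIntegers p)ˣ, (Ωp : ℂ_[p]) = θ (algebraMap F (CompletedAlgClosure F) ((a : 𝒪[F]) : F)) := by
  obtain ⟨Ωp, hΩp⟩ := exists_units_unrIntegers_coe_eq_theta_toC hp θ hθ1
    (Units.map (algebraMap 𝒪[F] (maxUnramifiedCompletion F)).toMonoidHom a)
  refine ⟨Ωp, ?_⟩
  rw [hΩp, Units.coe_map, RingHom.toMonoidHom_eq_coe, MonoidHom.coe_coe, toC_algebraMap]

/-! ### §4. The lane's spelling: `Θ = θ.comp ((CBall F).subtype.comp (algebraMap (UnrCoeff F) (CBall F)))` -/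
/-- The lane's `Θ` on the discrete copy `UnrCoeff F` of `𝒪̂_{F_nr}` is `θ ∘ toC`. [cite: SerreLocalFields1979, Ch. II §5] -/
theorem thetaC_apply (θ : CompletedAlgClosure F →+* ℂ_[p]) (x : UnrCoeff F) :
    θ.comp ((CBall F).subtype.comp (algebraMap (UnrCoeff F) (CBall F))) x =
      θ (maxUnramifiedCompletion.toC F ((UnrCoeff.of F).symm x)) := by
  rw [RingHom.comp_apply, RingHom.comp_apply, Subring.subtype_apply, algebraMap_unrCoeff_coe]

/-- `Θ ∘ intToUnrCoeff = θ ∘ (F → ℂ_F)` on `𝒪[F]` (the `hρ`-compatibility of the lane's readings). [cite: SerreLocalFields1979, Ch. II §5] -/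
theorem thetaC_intToUnrCoeff (θ : CompletedAlgClosure F →+* ℂ_[p]) (a : 𝒪[F]) :
    θ.comp ((CBall F).subtype.comp (algebraMap (UnrCoeff F) (CBall F))) (intToUnrCoeff F a) =
      θ (algebraMap F (CompletedAlgClosure F) (a : F)) := by
  rw [thetaC_apply, ← toC_algebraMap]; rfl

/-- The lane's hypothesis `hθ1 : ∀ z : CBall F, ‖θ z‖ ≤ 1` in the form used above. [folklore] -/
private theorem norm_theta_le_one_of_cBall (θ : CompletedAlgClosure F →+* ℂ_[p])
    (hθ1 : ∀ z : CBall F, ‖θ (z : CompletedAlgClosure F)‖ ≤ 1) (z : CompletedAlgClosure F) (hz : ‖z‖ ≤ 1) :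
    ‖θ z‖ ≤ 1 :=
  hθ1 ⟨z, (LubinTate.mem_unitBall_iff _).mpr hz⟩

/-- ★ **`Θ` maps `UnrCoeff F = 𝒪̂_{F_nr}` into `R₀`** (lane spelling). [cite: SerreLocalFields1979, Ch. II §5] -/
theorem mem_unrIntegers_thetaC (hp : Irreducible ((p : ℕ) : 𝒪[F])) (θ : CompletedAlgClosure F →+* ℂ_[p])
    (hθ1 : ∀ z : CBall F, ‖θ (z : CompletedAlgClosure F)‖ ≤ 1) (x : UnrCoeff F) :
    θ.comp ((CBall F).subtype.comp (algebraMap (UnrCoeff F) (CBall F))) x ∈ unrIntegers p := by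
  rw [thetaC_apply]
  exact mem_unrIntegers_theta_toC hp θ (norm_theta_le_one_of_cBall θ hθ1) _

/-- ★ **`Θ` maps units of `UnrCoeff F` into `R₀ˣ`** (lane spelling). [cite: deShalit1987, II.4.12 (31) (p. 67)] -/
theorem exists_units_unrIntegers_coe_eq_thetaC_of_isUnit (hp : Irreducible ((p : ℕ) : 𝒪[F]))
    (θ : CompletedAlgClosure F →+* ℂ_[p]) (hθ1 : ∀ z : CBall F, ‖θ (z : CompletedAlgClosure F)‖ ≤ 1)
    {x : UnrCoeff F} (hx : IsUnit x) :
    ∃ Ωp : (unrIntegers p)ˣ,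
      (Ωp : ℂ_[p]) = θ.comp ((CBall F).subtype.comp (algebraMap (UnrCoeff F) (CBall F))) x := by
  obtain ⟨Ωp, hΩp⟩ := exists_units_unrIntegers_coe_eq_theta_toC hp θ (norm_theta_le_one_of_cBall θ hθ1)
    (Units.map (UnrCoeff.of F).symm.toRingHom.toMonoidHom hx.unit)
  refine ⟨Ωp, ?_⟩
  rw [hΩp, thetaC_apply, Units.coe_map, RingHom.toMonoidHom_eq_coe, MonoidHom.coe_coe, IsUnit.unit_spec]
  rfl

/-- ★★ **THE PERIOD UNIT of the seam identity**: for `ϑ = compSeriesC hπ hσ₀ u hε` (linear coefficient a unit, tree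
`isUnit_coeff_one_compSeriesC`) and `a ∈ 𝒪[F]ˣ`, `Θ(coeff 1 ϑ) · θ(a) = ↑Ωp` with `Ωp : (unrIntegers p)ˣ` — the shape
in which the lane's supply statement books the `p`-adic period. [cite: deShalit1987, II.4.12 (31) (p. 67)] -/
theorem exists_units_unrIntegers_coe_eq_thetaC_coeff_one_compSeriesC_mul (hp : Irreducible ((p : ℕ) : 𝒪[F]))
    (θ : CompletedAlgClosure F →+* ℂ_[p]) (hθ1 : ∀ z : CBall F, ‖θ (z : CompletedAlgClosure F)‖ ≤ 1)
    {π : 𝒪[F]} (hπ : (valuation F).IsUniformizer (π : F))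
    {σ₀ : absoluteGaloisGroup F} (hσ₀ : IsAbsArithFrob σ₀) (u : 𝒪[F]ˣ)
    {ε : (maxUnramifiedCompletion F)ˣ}
    (hε : maxUnramifiedCompletion.galAut F σ₀ (ε : maxUnramifiedCompletion F) =
      algebraMap 𝒪[F] (maxUnramifiedCompletion F) (u : 𝒪[F]) * (ε : maxUnramifiedCompletion F))
    (a : 𝒪[F]ˣ) :
    ∃ Ωp : (unrIntegers p)ˣ, (Ωp : ℂ_[p]) =
      θ.comp ((CBall F).subtype.comp (algebraMap (UnrCoeff F) (CBall F))) (PowerSeries.coeff 1 (compSeriesC hπ hσ₀ u hε)) *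
        θ (algebraMap F (CompletedAlgClosure F) ((a : 𝒪[F]) : F)) :=
  exists_units_unrIntegers_coe_eq_mul
    (exists_units_unrIntegers_coe_eq_thetaC_of_isUnit hp θ hθ1 (isUnit_coeff_one_compSeriesC hπ hσ₀ u hε))
    (exists_units_unrIntegers_coe_eq_theta_algebraMap hp θ (norm_theta_le_one_of_cBall θ hθ1) a)


/-! ### §5. The lane's hypothesis shape: `p` a uniformiser as `(valuation F).IsUniformizer p` (the datum's `h2`) -/
/-- ★ `Θ` maps `UnrCoeff F` into `R₀`; uniformiser hypothesis in the lane's form. [cite: SerreLocalFields1979, Ch. II §5] -/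
theorem mem_unrIntegers_thetaC_of_isUniformizer (hp : (valuation F).IsUniformizer ((((p : ℕ) : 𝒪[F]) : F)))
    (θ : CompletedAlgClosure F →+* ℂ_[p]) (hθ1 : ∀ z : CBall F, ‖θ (z : CompletedAlgClosure F)‖ ≤ 1) (x : UnrCoeff F) :
    θ.comp ((CBall F).subtype.comp (algebraMap (UnrCoeff F) (CBall F))) x ∈ unrIntegers p :=
  mem_unrIntegers_thetaC (irreducible_of_isUniformizer' hp) θ hθ1 x

/-- ★★ **THE PERIOD UNIT, lane shape**: the SAME `hp` builds `ϑ = compSeriesC hp hσ₀ u hε` (`π := p`, the lane's `h2`);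
`Θ(coeff 1 ϑ) · θ(a) = ↑Ωp` for a unit `Ωp` of `R₀`. [cite: deShalit1987, II.4.12 (31) (p. 67)] -/
theorem exists_units_unrIntegers_coe_eq_thetaC_coeff_one_compSeriesC_mul_of_isUniformizer
    (hp : (valuation F).IsUniformizer ((((p : ℕ) : 𝒪[F]) : F)))
    (θ : CompletedAlgClosure F →+* ℂ_[p]) (hθ1 : ∀ z : CBall F, ‖θ (z : CompletedAlgClosure F)‖ ≤ 1)
    {σ₀ : absoluteGaloisGroup F} (hσ₀ : IsAbsArithFrob σ₀) (u : 𝒪[F]ˣ)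
    {ε : (maxUnramifiedCompletion F)ˣ}
    (hε : maxUnramifiedCompletion.galAut F σ₀ (ε : maxUnramifiedCompletion F) =
      algebraMap 𝒪[F] (maxUnramifiedCompletion F) (u : 𝒪[F]) * (ε : maxUnramifiedCompletion F))
    (a : 𝒪[F]ˣ) :
    ∃ Ωp : (unrIntegers p)ˣ, (Ωp : ℂ_[p]) =
      θ.comp ((CBall F).subtype.comp (algebraMap (UnrCoeff F) (CBall F))) (PowerSeries.coeff 1 (compSeriesC hp hσ₀ u hε)) *
        θ (algebraMap F (CompletedAlgClosure F) ((a : 𝒪[F]) : F)) :=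
  exists_units_unrIntegers_coe_eq_thetaC_coeff_one_compSeriesC_mul (irreducible_of_isUniformizer' hp) θ hθ1 hp hσ₀ u hε a

/-- The same with the power distributed: `Θ(coeff 1 ϑ)^m · θ(a)^m = ↑(Ωp^m)`. [cite: deShalit1987, II.4.12 (31) (p. 67)] -/
theorem exists_units_unrIntegers_thetaC_coeff_one_compSeriesC_pow_mul_pow_eq_of_isUniformizer
    (hp : (valuation F).IsUniformizer ((((p : ℕ) : 𝒪[F]) : F)))
    (θ : CompletedAlgClosure F →+* ℂ_[p]) (hθ1 : ∀ z : CBall F, ‖θ (z : CompletedAlgClosure F)‖ ≤ 1)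
    {σ₀ : absoluteGaloisGroup F} (hσ₀ : IsAbsArithFrob σ₀) (u : 𝒪[F]ˣ)
    {ε : (maxUnramifiedCompletion F)ˣ}
    (hε : maxUnramifiedCompletion.galAut F σ₀ (ε : maxUnramifiedCompletion F) =
      algebraMap 𝒪[F] (maxUnramifiedCompletion F) (u : 𝒪[F]) * (ε : maxUnramifiedCompletion F))
    (a : 𝒪[F]ˣ) :
    ∃ Ωp : (unrIntegers p)ˣ, ∀ m : ℕ,
      θ.comp ((CBall F).subtype.comp (algebraMap (UnrCoeff F) (CBall F))) (PowerSeries.coeff 1 (compSeriesC hp hσ₀ u hε)) ^ m *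
          θ (algebraMap F (CompletedAlgClosure F) ((a : 𝒪[F]) : F)) ^ m =
        ((Ωp ^ m : (unrIntegers p)ˣ) : unrIntegers p) := by
  obtain ⟨Ωp, hΩp⟩ :=
    exists_units_unrIntegers_coe_eq_thetaC_coeff_one_compSeriesC_mul_of_isUniformizer hp θ hθ1 hσ₀ u hε a
  refine ⟨Ωp, fun m ↦ ?_⟩
  rw [← mul_pow, ← hΩp, Units.val_pow_eq_pow_val, Subring.coe_pow]

end Literature.NumberTheory.PAdicHodge

end
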